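import Summits.QuantumFields.BalabanUV.T4Continuum.Support.DirichletSplittableTwoLevel
import Summits.QuantumFields.BalabanUV.T4Continuum.Support.DirichletDecoupledScattered

/-!
# `BalabanUV.T4Continuum.Support.DirichletSplittableExamples` — NE2 (node U1a) formalisation swarm, SUPPLIER item «Δ1-LOCAL» under the
# owner's sub-row `T4-U1a.S-NE2-D1-DIRICHLET°`: THE CLASS OF «Δ1-LOCAL» CONTAINS THE CLASSES OF GEN 4 — every block set all of whose
# FACE-CONNECTED COMPONENTS are locally monotone, and every SCATTERED block set, is LOCALLY SPLITTABLE (kernel inclusions; consistency ENDs)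
# (unit b2b-balaban-t4-ne2-formalise-leaf-08, gen 5, file 5 — examples ∕ inclusions only)

HONEST FRAMING.  Rung (B)+1 bookkeeping at MODEL level (U = 1 scalar layer), finite torus; pure combinatorics + composition BY NAME; NE2
(U1a) is NOT proved by this file; spine PROVED 0/9 unchanged; NOT infinite volume, NOT the mass gap, NOT Clay.  HONEST DEPENDENCY (verbatim):
«continuum YM on T⁴ ⇐ BetaPertH ∧ nine spine estimates (0/9 proved); BetaPertH ⇐ (D1) ∧ (D4) ∧ CAP+tail; G-an2-4 gates asym, D1 and
NE2/3/4.»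

WHAT THIS FILE PROVES (0 sorry; gen 4's `DirichletDecoupledComponents.{faceGraphOn, compOf}`, `DirichletDecoupledScattered.Scattered` and
files 1–4 BY NAME):
 * **`locallySplittable_of_components_locallyMonotone`**: if every face-connected component `compOf M S c` is locally monotone (gen 4's
   class, which contains gen 3's by `locallyMonotone_compOf`), then `S` is locally splittable — colour a block by «my component is
   downward-closed at `(v, μ)`»: face-adjacent blocks share the component, hence the colour;
 * **`pillarFree_of_scattered`**, **`locallySplittable_of_scattered`**: a scattered block set (no two blocks share a face) has no pillar;
 * consistency ENDs through files 1–4: `injected_le_of_components_locallyMonotone'` (rate `√R/√N`, this route's constant `splitConst`),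
   `towerLimitRate_dirichletScalar_components_monotone'` and `…_scattered'` at the rate `(√L)⁻¹` (gen 4's `…_scattered` has the torus
   rate `L⁻¹` through the box law — recorded as the weaker consistency face).
 So the single hypothesis `LocallySplittable M S` of file 4's ENDs SUBSUMES every class on which the Ω-restricted `U = 1` scalar tower
 was in the tree before (boxes, locally monotone sets, separated unions, component classes, scattered sets) and adds the single-component
 non-monotone configurations whose contact vertices are pillar-free (file 1's criterion).

ABSOLUTE RULE (cell, verbatim): «No internally-minted statement may enter as a cited fact. Every hypothesis is either kernel-proved in
this package or a verbatim quotation of a PUBLISHED theorem with page reference. The manuscript(s) under audit are NOT citable for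
their own disputed steps — they are the thing under adjudication; programme-internal (2001/route/tribunal) claims are never citable.»
[folklore]; no `def … : Prop` fact.  NOT CLAIMED: the spiral 4-chain and kin; rate `L^{−1}`; the VECTOR layer; NE2; NE3; «not in print».
-/

noncomputable section

open scoped BigOperators ComplexConjugate Matrix Matrix.Norms.L2Operator

namespace Summit.QuantumFields.BalabanUV.T4Continuum.DirichletSplittableExamples

open Literature.MathematicalPhysics.QuantumFieldTheory.Balaban1983to89.B5Prop11Plancherel (Tor fine unitVec)
open Literature.MathematicalPhysics.QuantumFieldTheory.Balaban1983to89.B5G183RateUnitTower (lev lev_neZero)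
open Summit.QuantumFields.BalabanUV.T4Continuum
open Summit.QuantumFields.BalabanUV.T4Continuum.CovariantAveragingTower (TowerLimitRate)
open Summit.QuantumFields.BalabanUV.T4Continuum.BackgroundResolventTower
open Summit.QuantumFields.BalabanUV.T4Continuum.ScalarAveragedPropagator (gammaPs)
open Summit.QuantumFields.BalabanUV.T4Continuum.DirichletMonotoneCutoff (InPatch DownClosed UpClosed LocallyMonotone)
open Summit.QuantumFields.BalabanUV.T4Continuum.DirichletSplitPieces (AdjConst SplittableAt LocallySplittable PillarFree
  splittableAt_of_pillarFree locallySplittable_of_locallyMonotone locallySplittable_of_monotone_or_pillarFree add_unitVec_apply_self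
  add_unitVec_apply_ne)
open Summit.QuantumFields.BalabanUV.T4Continuum.DirichletSplittableTwoLevel (splitConst injected_le_of_locallySplittable
  towerLimitRate_dirichletScalar_splittable)
open Summit.QuantumFields.BalabanUV.T4Continuum.DirichletScalarTower
open Summit.QuantumFields.BalabanUV.T4Continuum.DirichletDecoupledComponents (faceGraph faceGraphOn faceGraph_adj faceGraphOn_adj compOf
  locallyMonotone_compOf)
open Summit.QuantumFields.BalabanUV.T4Continuum.DirichletDecoupledScattered (Scattered)
open Summit.QuantumFields.BalabanUV.Beta.GAN24.DirichletBoxCompression (DOm JOm refineR)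
open Summit.QuantumFields.BalabanUV.Beta.GAN24.DirichletBoxTrace (blockReg)

variable {d : ℕ} (M : Fin d → ℕ) [hM : ∀ μ, NeZero (M μ)] (S : Tor M → Prop)

/-! ## §1 Component classes are locally splittable -/

omit hM in
/-- face-adjacent (or equal) blocks of `S` lie in the same face-connected component. [folklore] -/
theorem mk_eq_of_adj {b b' : Tor M} (hb : S b) (hb' : S b') {ν : Fin d} (hadj : b' = b + unitVec M ν ∨ b = b' + unitVec M ν) :
    (faceGraphOn M S).connectedComponentMk ⟨b, hb⟩ = (faceGraphOn M S).connectedComponentMk ⟨b', hb'⟩ := by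
  by_cases heq : b = b'
  · subst heq; rfl
  · have h : (faceGraphOn M S).Adj ⟨b, hb⟩ ⟨b', hb'⟩ :=
      (faceGraphOn_adj M S _ _).mpr ((faceGraph_adj M b b').mpr ⟨heq, ν, hadj⟩)
    exact SimpleGraph.ConnectedComponent.sound h.reachable

omit hM in
/-- **EVERY BLOCK SET ALL OF WHOSE FACE-CONNECTED COMPONENTS ARE LOCALLY MONOTONE IS LOCALLY SPLITTABLE** (gen 4's class ⊆ «Δ1-LOCAL»'s):
colour a block of `S` by «my component is downward-closed at `(v, μ)`». [folklore] -/
theorem locallySplittable_of_components_locallyMonotone (hcomp : ∀ c, LocallyMonotone M (compOf M S c)) : LocallySplittable M S := by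
  intro v μ
  -- the colouring
  refine ⟨fun b => ∃ h : S b, DownClosed M (compOf M S ((faceGraphOn M S).connectedComponentMk ⟨b, h⟩)) v μ, ?_, ?_, ?_⟩
  · -- constant across internal faces: adjacent blocks share the component
    intro b ν _ _ hb hb'
    constructor
    · rintro ⟨h, hD⟩; exact ⟨hb', by rwa [← mk_eq_of_adj M S h hb' (Or.inl rfl)]⟩
    · rintro ⟨h, hD⟩; exact ⟨hb, by rwa [mk_eq_of_adj M S hb h (Or.inl rfl)]⟩
  · -- the down class is downward-closed
    rintro b hP hu ⟨hb, ⟨h, hD⟩⟩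
    have hmem : compOf M S ((faceGraphOn M S).connectedComponentMk ⟨b, h⟩) b := ⟨h, rfl⟩
    obtain ⟨hS', hc'⟩ := hD b hP hu hmem
    refine ⟨hS', hS', ?_⟩
    rwa [hc']
  · -- the up class is upward-closed
    rintro b hP hl ⟨hb, hnot⟩
    set c := (faceGraphOn M S).connectedComponentMk ⟨b, hb⟩ with hc
    have hmem : compOf M S c b := ⟨hb, rfl⟩
    have hU : UpClosed M (compOf M S c) v μ := by
      rcases hcomp c v μ with hD | hU
      · exact absurd ⟨hb, hD⟩ hnot
      · exact hU
    obtain ⟨hS', hc'⟩ := hU b hP hl hmem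
    refine ⟨hS', fun ⟨h', hD'⟩ => hnot ⟨hb, ?_⟩⟩
    rwa [hc'] at hD'

omit hM in
/-- a SCATTERED block set has no pillar at any vertex. [folklore] -/
theorem pillarFree_of_scattered (h : Scattered M S) (v : Tor M) (μ : Fin d) : PillarFree M S v μ := by
  intro b _ _ hb hb'
  have e := h b (b + unitVec M μ) hb hb' μ rfl
  exact add_eq_left.mp e

omit hM in
/-- **every scattered block set is locally splittable** (gen 4's scattered class ⊆). [folklore] -/
theorem locallySplittable_of_scattered (h : Scattered M S) : LocallySplittable M S :=
  fun v μ => splittableAt_of_pillarFree M (pillarFree_of_scattered M S h v μ)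

/-! ## §2 Consistency ENDs through «Δ1-LOCAL» -/

section Ends

variable (N R : ℕ) [NeZero N] [NeZero R] [DecidablePred S]

/-- gen 4's component class through file 4's END (this route's constant `splitConst`; gen 4 has `besovConst d a′ 6 48`). [folklore] -/
theorem injected_le_of_components_locallyMonotone' (hcomp : ∀ c, LocallyMonotone M (compOf M S c)) (hN : 1 ≤ N) (hRN : 2 ≤ R * N)
    {a' : ℝ} (ha' : 0 < a') :
    ‖(DOm (R * N) M a' (refineR N R M (blockReg N M S)))⁻¹ * JOm N R M (blockReg N M S)
        - JOm N R M (blockReg N M S) * (DOm N M a' (blockReg N M S))⁻¹‖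
      ≤ splitConst d a' * Real.sqrt R / Real.sqrt N :=
  injected_le_of_locallySplittable N R M S (locallySplittable_of_components_locallyMonotone M S hcomp) hN hRN ha'

variable (L : ℕ) [NeZero L] (a' : ℝ)

/-- gen 4's component tower END through file 4 (same rate `(√L)⁻¹`, this route's constant). [folklore] -/
theorem towerLimitRate_dirichletScalar_components_monotone' (hL : 2 ≤ L) (hd : 0 < d) (ha' : 0 < a')
    (hcomp : ∀ c, LocallyMonotone M (compOf M S c)) :
    TowerLimitRate (QsR L M (blockReg (lev L 0) M S)) ((L : ℝ) ^ d) (fun k => (DsR L M a' (blockReg (lev L 0) M S) k)⁻¹)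
      (Cpert 0 (2 * d * Real.sqrt ((gammaPs d a')⁻¹)) (splitConst d a' * Real.sqrt (L : ℝ)) 0 0 0) ((Real.sqrt (L : ℝ))⁻¹) :=
  towerLimitRate_dirichletScalar_splittable L M a' S hL hd ha' (locallySplittable_of_components_locallyMonotone M S hcomp)

/-- the scattered tower END through file 4 — the weaker consistency face (gen 4's `towerLimitRate_dirichletScalar_scattered` has the torus
rate `L⁻¹` through road P2's box law). [folklore] -/
theorem towerLimitRate_dirichletScalar_scattered' (hL : 2 ≤ L) (hd : 0 < d) (ha' : 0 < a') (h : Scattered M S) :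
    TowerLimitRate (QsR L M (blockReg (lev L 0) M S)) ((L : ℝ) ^ d) (fun k => (DsR L M a' (blockReg (lev L 0) M S) k)⁻¹)
      (Cpert 0 (2 * d * Real.sqrt ((gammaPs d a')⁻¹)) (splitConst d a' * Real.sqrt (L : ℝ)) 0 0 0) ((Real.sqrt (L : ℝ))⁻¹) :=
  towerLimitRate_dirichletScalar_splittable L M a' S hL hd ha' (locallySplittable_of_scattered M S h)

/-- CONSISTENCY (kernel): gen 3's class through gen 4's `locallyMonotone_compOf` and §1. -/
example (hS : LocallyMonotone M S) : LocallySplittable M S :=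
  locallySplittable_of_components_locallyMonotone M S (locallyMonotone_compOf S hS)

end Ends

/-! ## §3 Two dimensions: EVERY block set is locally splittable -/

section TwoDim

variable (M₂ : Fin 2 → ℕ) [hM₂ : ∀ μ, NeZero (M₂ μ)] (S₂ : Tor M₂ → Prop)

omit hM₂ in
/-- a block of a two-dimensional block torus is determined by its two coordinates. [folklore] -/
theorem eq_of_apply_eq₂ {b b' : Tor M₂} {μ ν : Fin 2} (hμν : μ ≠ ν) (hμ : b μ = b' μ) (hν : b ν = b' ν) : b = b' := by
  funext κ
  fin_cases μ <;> fin_cases ν <;> fin_cases κ <;> first | exact absurd rfl hμν | assumption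

omit hM₂ in
/-- **IN TWO DIMENSIONS EVERY VERTEX PATCH IS MONOTONE OR PILLAR-FREE ALONG EVERY AXIS**: a patch that is neither downward- nor
upward-closed along `μ` is the diagonal pair, which has no `μ`-pillar. [folklore] -/
theorem monotone_or_pillarFree₂ (v : Tor M₂) (μ : Fin 2) :
    DownClosed M₂ S₂ v μ ∨ UpClosed M₂ S₂ v μ ∨ PillarFree M₂ S₂ v μ := by
  classical
  by_cases hD : DownClosed M₂ S₂ v μ
  · exact Or.inl hD
  by_cases hU : UpClosed M₂ S₂ v μ
  · exact Or.inr (Or.inl hU)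
  refine Or.inr (Or.inr fun b hP hl hS hS' => ?_)
  exfalso
  simp only [DownClosed, UpClosed, not_forall] at hD hU
  obtain ⟨b₂, hP₂, hu₂, hS₂, hn₂⟩ := hD
  obtain ⟨b₁, hP₁, hl₁, hS₁, hn₁⟩ := hU
  -- the other axis
  obtain ⟨ν, hνμ⟩ : ∃ ν : Fin 2, ν ≠ μ := ⟨μ + 1, by fin_cases μ <;> decide⟩
  -- `μ`-coordinates: `b`, `b₁` lower, `b₂` and `b + e_μ` upper
  have hbμ : b μ = b₁ μ := add_right_cancel (hl.symm.trans hl₁)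
  have hb'μ : (b + unitVec M₂ μ) μ = b₂ μ := by rw [add_unitVec_apply_self, ← hl, hu₂]
  have hb₁'μ : (b₁ + unitVec M₂ μ) μ = b₂ μ := by rw [add_unitVec_apply_self, ← hl₁, hu₂]
  have hb'ν : (b + unitVec M₂ μ) ν = b ν := add_unitVec_apply_ne M₂ b hνμ
  have hb₁'ν : (b₁ + unitVec M₂ μ) ν = b₁ ν := add_unitVec_apply_ne M₂ b₁ hνμ
  -- `ν`-coordinates take two values
  by_cases h1 : b ν = b₁ ν
  · exact hn₁ (eq_of_apply_eq₂ M₂ hνμ.symm hbμ h1 ▸ hS')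
  by_cases h2 : b ν = b₂ ν
  · have e : b + unitVec M₂ μ = b₂ := eq_of_apply_eq₂ M₂ hνμ.symm hb'μ (hb'ν.trans h2)
    exact hn₂ (by rw [← e, add_sub_cancel_right]; exact hS)
  have h12 : b₁ ν = b₂ ν := by
    rcases hP ν with h | h <;> rcases hP₁ ν with h' | h' <;> rcases hP₂ ν with h'' | h''
    all_goals first
      | exact absurd (add_right_cancel (h.symm.trans h')) h1
      | exact absurd (h.symm.trans h') h1
      | exact absurd (add_right_cancel (h.symm.trans h'')) h2
      | exact absurd (h.symm.trans h'') h2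
      | exact add_right_cancel (h'.symm.trans h'')
      | exact h'.symm.trans h''
  have e : b₁ + unitVec M₂ μ = b₂ := eq_of_apply_eq₂ M₂ hνμ.symm hb₁'μ (hb₁'ν.trans h12)
  exact hn₁ (e ▸ hS₂)

omit hM₂ in
/-- **IN TWO DIMENSIONS EVERY BLOCK SET IS LOCALLY SPLITTABLE.** [folklore] -/
theorem locallySplittable₂ : LocallySplittable M₂ S₂ :=
  locallySplittable_of_monotone_or_pillarFree M₂ (monotone_or_pillarFree₂ M₂ S₂)

variable (N R : ℕ) [NeZero N] [NeZero R] [DecidablePred S₂]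

/-- **THE DIRICHLET TWO-LEVEL INJECTED LAW FOR EVERY UNION OF UNIT BLOCKS OF A TWO-DIMENSIONAL TORUS** (U = 1 scalar model):
NO hypothesis on the block set. [folklore] -/
theorem injected_le₂ (hN : 1 ≤ N) (hRN : 2 ≤ R * N) {a' : ℝ} (ha' : 0 < a') :
    ‖(DOm (R * N) M₂ a' (refineR N R M₂ (blockReg N M₂ S₂)))⁻¹ * JOm N R M₂ (blockReg N M₂ S₂)
        - JOm N R M₂ (blockReg N M₂ S₂) * (DOm N M₂ a' (blockReg N M₂ S₂))⁻¹‖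
      ≤ splitConst 2 a' * Real.sqrt R / Real.sqrt N :=
  injected_le_of_locallySplittable N R M₂ S₂ (locallySplittable₂ M₂ S₂) hN hRN ha'

variable (L : ℕ) [NeZero L] (a' : ℝ)

/-- **THE Ω-RESTRICTED UNIT-LATTICE SCALAR FREE COVARIANCES CONVERGE AT RATE `(√L)⁻¹` FOR EVERY UNION OF UNIT BLOCKS OF A
TWO-DIMENSIONAL TORUS** (`L ≥ 2`, `a′ > 0`) — the `U = 1` scalar Dirichlet layer of Δ1 has NO located residue in `d = 2`. [folklore] -/
theorem towerLimitRate_dirichletScalar₂ (hL : 2 ≤ L) (ha' : 0 < a') :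
    TowerLimitRate (QsR L M₂ (blockReg (lev L 0) M₂ S₂)) ((L : ℝ) ^ 2) (fun k => (DsR L M₂ a' (blockReg (lev L 0) M₂ S₂) k)⁻¹)
      (Cpert 0 (2 * (2 : ℕ) * Real.sqrt ((gammaPs 2 a')⁻¹)) (splitConst 2 a' * Real.sqrt (L : ℝ)) 0 0 0) ((Real.sqrt (L : ℝ))⁻¹) :=
  towerLimitRate_dirichletScalar_splittable L M₂ a' S₂ hL (by norm_num) ha' (locallySplittable₂ M₂ S₂)

end TwoDim

end Summit.QuantumFields.BalabanUV.T4Continuum.DirichletSplittableExamples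

end
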